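/-
Copyright (c) 2026 the pub-hodgecm-mathlib formalisation cell (harness21).  Prover seat hodgecm-mathlib-K2E4-p23 (g2), Track B ∕ K2-LIT, h413 =
`stmt-HodgeConjecture-24833`, ENGINE E1, 5Res campaign «ENDGAME BY FAMILIES», ROADCARD §3′ (M2 v2), deal (254) of K2E1-plan (g7): the ENDGAME BRIDGE «D5′ ⇒ hatoms» at
`U(H)(𝔸_{L⁺})` — ★ (β) per family block feeds K2E4-p14's ★ `hatoms_of_noLineMass`; hypothesis-first on the per-block model letters and on `hPfix ∕ hEXH ∕ hPEis`.
-/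
import Summits.HodgeConjecture.HodgeConjecture.Theorems.K2E1IrreducibleNoContinuousSpectrumCMTwoOfLetters   -- ★ p860487 (this seat) (β)
import Summits.HodgeConjecture.HodgeConjecture.Theorems.K2E1ResidueAtomsOfNoLineMassU                    -- ★ (K2E4-p14) `hatoms_of_noLineMass`
import HarnessLib

/-!
# K2·E1 — `K2E1ResidualPartInAtomsCMTwo`: «D5′ ⇒ hatoms» — THE RESIDUAL IRREDUCIBLES OF `U(H)(𝔸_{L⁺})` PROJECT INTO A FINITE-DIMENSIONAL ATOM SPACE AT EVERY `(χ, U)`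
# (ROADCARD §3′ endgame bridge, deal (254): ★ (β) per family block `b` discharges the `hD5` letter of ★ `hatoms_of_noLineMass`; every `N`, every `H`)

Track B ∕ K2-LIT, crux h413 = `stmt-HodgeConjecture-24833`, route of record `HCCMUnconditional`; cell `hodgecm-mathlib`, squad K2, ENGINE E1 (5Res campaign, M2 v2).  Prover seat
`hodgecm-mathlib-K2E4-p23` (g2); deal (254).  THEOREMS ONLY (no `def`, no `instance`, no notation, no named-fact hypothesis, no `sorry`); lane
`--supports stmt-HodgeConjecture-24833 --as helper` (count-neutral).  CLOSES NO SOCKET.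

WHAT.  `π = R` the right regular representation of `U(H)(𝔸_{L⁺}) = (cmDatum L N H).Adelic` on `L²(μ)` (★ `isUnitary_rightRegular`, ★ `isStronglyContinuous_rightRegular_holds`); the block projector
`P = P_χ ∘L R_f(e)` of ★ `K2E1HeckeAlgebraLettersCM` (binder `hPdef`); FINITELY many family blocks `b : β` with coordinate maps `U b : L² →ₗ[ℂ] A_b × L²(Ω_b; E_b)` (`A_b` finite-dimensional atoms
— K2E4-p14's currency, PLAIN product).
* §1 **`hD5_of_letters`** — for each block `b`, the per-block letters of ★ (β) ((L1) `T b ∕ hT𝓐 ∕ hTP ∕ hTB`, (L2) `s b ∕ hs ∕ hU` on the SECOND coordinate of `U b`, (L3) `hline`) give, by ★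
  `lpModel_blockProj_eq_zero_of_irreducible_subrep_cm` applied to `snd ∘ U b`: for EVERY irreducible closed `W ≤ L²` (a fortiori `W ≤ L²_res`) and `w ∈ W`, `(U b (P w)).2 = 0` — the `hD5`
  binder of ★ `hatoms_of_noLineMass` VERBATIM.
* §2 **`hatoms_of_letters`** — ★ `hatoms_of_noLineMass` ∘ §1: with `hPfix` ((S2c), K2E2-p12), `Eis ∕ hEXH` (★ p860422 + C7 finite), `hPEis` (C7's `Eis`-currency) the `hatoms` clause of ★
  `levelFinite_of_atoms` at `(χ, U₀)` follows.  (§3, the quantification over all `(χ, U₀)` and the plug into ★ `levelFinite_of_atoms` ∕ `residualSpectrumCompact_of_admissible`, is the final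
  assembly's business: it needs the data of §2 for every `(χ, U₀)`.)
HONEST LABEL: HC_CM is proved only modulo the 7 printed citations (2 remaining named inputs: hLiu418 = `stmt-HodgeConjecture-24832`, h413 = `stmt-HodgeConjecture-24833`) until rung 0
closes; this file asserts no named fact, is conditional by construction on the visible letters, and closes no socket; count-neutral.

## References
* [MoeglinWaldspurger1995] C. Mœglin, J.-L. Waldspurger, *Spectral decomposition and Eisenstein series* (1995), I.2.18, IV.3.12, V.3.13, VI.2.
* [BorelJacquet1979] A. Borel, H. Jacquet, PSPM 33.1 (1979), §4.6.
-/

set_option autoImplicit false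
-- the mandated namespace repeats the single-problem summit's segment (`HodgeConjecture.HodgeConjecture`)
set_option linter.dupNamespace false

noncomputable section

open MeasureTheory Filter Topology CompactlySupported NumberField ContRepresentation Set
open scoped InnerProductSpace ENNReal ComplexConjugate
open Literature.NumberTheory.Automorphic Literature.NumberTheory.Automorphic.UnitaryGroup AdelicGroupData
open Summit.HodgeConjecture.HodgeConjecture.Cruxes.H413.K2E1IrreducibleNoContinuousSpectrumCMTwoOfLetters (lpModel_blockProj_eq_zero_of_irreducible_subrep_cm)
open Summit.HodgeConjecture.HodgeConjecture.Cruxes.H413.K2E1ResidueAtomsOfNoLineMassU (hatoms_of_noLineMass)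
open Summit.HodgeConjecture.HodgeConjecture.Cruxes.H413.K2E1CuspidalSpectrumUnitary
open Summit.HodgeConjecture.HodgeConjecture.Cruxes.H413.K2E1HeckeAlgebraLettersCM

namespace Summit.HodgeConjecture.HodgeConjecture.Cruxes.H413.K2E1ResidualPartInAtomsCMTwo

variable {L : Type} [Field L] [NumberField L] [IsCMField L] {N : ℕ} {H : Matrix (Fin N) (Fin N) L}
  (μ : Measure (cmDatum L N H).automorphicQuotient) [(cmDatum L N H).IsAutomorphicMeasure μ]
  {K : Type*} [Group K] [TopologicalSpace K] [MeasurableSpace K] [BorelSpace K]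
  [MeasurableSpace (UnitaryGroup.arch (↥(maximalRealSubfield L)) L (IsCMField.complexConj L) N H)] [BorelSpace (UnitaryGroup.arch (↥(maximalRealSubfield L)) L (IsCMField.complexConj L) N H)]
  [MeasurableSpace (finAdelic (↥(maximalRealSubfield L)) L (IsCMField.complexConj L) N H)] [BorelSpace (finAdelic (↥(maximalRealSubfield L)) L (IsCMField.complexConj L) N H)]
  (νinf : Measure (UnitaryGroup.arch (↥(maximalRealSubfield L)) L (IsCMField.complexConj L) N H)) [IsFiniteMeasureOnCompacts νinf] [νinf.IsMulLeftInvariant] [νinf.IsInvInvariant] [νinf.IsOpenPosMeasure]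
  (νf : Measure (finAdelic (↥(maximalRealSubfield L)) L (IsCMField.complexConj L) N H)) [IsFiniteMeasureOnCompacts νf] [νf.IsMulLeftInvariant] [νf.IsInvInvariant] [νf.IsOpenPosMeasure]
  (κ : K →* UnitaryGroup.arch (↥(maximalRealSubfield L)) L (IsCMField.complexConj L) N H) (hκ : Continuous κ)
  (μK : Measure K) [IsFiniteMeasureOnCompacts μK] [IsProbabilityMeasure μK] [MeasurableMul K] [μK.IsMulLeftInvariant] [MeasurableInv K] [μK.IsInvInvariant]
  (χ : C_c(K, ℂ)) (e : C_c(finAdelic (↥(maximalRealSubfield L)) L (IsCMField.complexConj L) N H, ℂ))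
  {β : Type*} [Finite β] {A : β → Type*} [∀ b, AddCommGroup (A b)] [∀ b, Module ℂ (A b)] [∀ b, FiniteDimensional ℂ (A b)]
  {Ω : β → Type*} {mΩ : ∀ b, MeasurableSpace (Ω b)} (m : ∀ b, Measure (Ω b)) {E : β → Type*} [∀ b, NormedAddCommGroup (E b)] [∀ b, NormedSpace ℂ (E b)]
  (Jb : β → Type*) [∀ b, Countable (Jb b)]
variable [ENNReal.HolderTriple ∞ 2 2]

/-! ## §1 `hD5` from the per-block (β)-letters -/

omit [Finite β] [∀ b, FiniteDimensional ℂ (A b)] in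
/-- **`hD5` OF ★ `hatoms_of_noLineMass` FROM THE PER-BLOCK LETTERS OF ★ (β)**: for every block `b`, ★ `lpModel_blockProj_eq_zero_of_irreducible_subrep_cm` applied to the second coordinate
`snd ∘ U b` gives `(U b (P w)).2 = 0` for every irreducible closed `W ≤ L²(μ)` and `w ∈ W` (the residual hypothesis `W ≤ L²_res` of the binder is not even needed).
[cite: MoeglinWaldspurger1995, IV.3.12, VI.2] -/
theorem hD5_of_letters
    (hχmul : ∀ k l, χ (k * l) = χ k * χ l) (hχone : χ 1 = 1) (hχinv : ∀ k, conj (χ k⁻¹) = χ k)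
    (K' : Subgroup (finAdelic (↥(maximalRealSubfield L)) L (IsCMField.complexConj L) N H)) (he0 : ∀ x, x ∉ K' → e x = 0) (he1 : ∫ x, e x ∂νf = 1)
    (heK : ∀ k ∈ K', ∀ x, e (k * x) = e x) (hestar : ∀ x, mulStar (⇑e) x = e x)
    (P : (cmDatum L N H).L2 μ →L[ℂ] (cmDatum L N H).L2 μ) (hPdef : P = ((((cmDatum L N H).rightRegular μ).restrict ((archToAdelic (↥(maximalRealSubfield L)) L (IsCMField.complexConj L) N H).comp κ)).integratedOperator (((cmDatum L N H).isUnitary_rightRegular μ).restrict _)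
          (((cmDatum L N H).isStronglyContinuous_rightRegular_holds μ).restrict _ ((continuous_archToAdelic (↥(maximalRealSubfield L)) L (IsCMField.complexConj L) N H).comp hκ)) μK χ ∘L
        (((cmDatum L N H).rightRegular μ).restrict (finAdelicToAdelic (↥(maximalRealSubfield L)) L (IsCMField.complexConj L) N H)).integratedOperator (((cmDatum L N H).isUnitary_rightRegular μ).restrict _) (((cmDatum L N H).isStronglyContinuous_rightRegular_holds μ).restrict _ (continuous_finAdelicToAdelic (↥(maximalRealSubfield L)) L (IsCMField.complexConj L) N H)) νf e))
    (U : ∀ b, (cmDatum L N H).L2 μ →ₗ[ℂ] (A b × Lp (E b) 2 (m b)))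
    (T : ∀ b, Jb b → (cmDatum L N H).L2 μ →L[ℂ] (cmDatum L N H).L2 μ) (hT𝓐 : ∀ b j, T b j ∈ {A' : (cmDatum L N H).L2 μ →L[ℂ] (cmDatum L N H).L2 μ | ∃ (a : C_c(UnitaryGroup.arch (↥(maximalRealSubfield L)) L (IsCMField.complexConj L) N H, ℂ)) (b : C_c(finAdelic (↥(maximalRealSubfield L)) L (IsCMField.complexConj L) N H, ℂ)),
      A' = (((cmDatum L N H).rightRegular μ).restrict (archToAdelic (↥(maximalRealSubfield L)) L (IsCMField.complexConj L) N H)).integratedOperator (((cmDatum L N H).isUnitary_rightRegular μ).restrict _) (((cmDatum L N H).isStronglyContinuous_rightRegular_holds μ).restrict _ (continuous_archToAdelic (↥(maximalRealSubfield L)) L (IsCMField.complexConj L) N H)) νinf a ∘L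
          (((cmDatum L N H).rightRegular μ).restrict (finAdelicToAdelic (↥(maximalRealSubfield L)) L (IsCMField.complexConj L) N H)).integratedOperator (((cmDatum L N H).isUnitary_rightRegular μ).restrict _) (((cmDatum L N H).isStronglyContinuous_rightRegular_holds μ).restrict _ (continuous_finAdelicToAdelic (↥(maximalRealSubfield L)) L (IsCMField.complexConj L) N H)) νf b})
    (hTP : ∀ b j, Commute P (T b j))
    (hTB : ∀ b j, ∀ A' ∈ {A' : (cmDatum L N H).L2 μ →L[ℂ] (cmDatum L N H).L2 μ | ∃ (a : C_c(UnitaryGroup.arch (↥(maximalRealSubfield L)) L (IsCMField.complexConj L) N H, ℂ)) (b : C_c(finAdelic (↥(maximalRealSubfield L)) L (IsCMField.complexConj L) N H, ℂ)),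
      A' = (((cmDatum L N H).rightRegular μ).restrict (archToAdelic (↥(maximalRealSubfield L)) L (IsCMField.complexConj L) N H)).integratedOperator (((cmDatum L N H).isUnitary_rightRegular μ).restrict _) (((cmDatum L N H).isStronglyContinuous_rightRegular_holds μ).restrict _ (continuous_archToAdelic (↥(maximalRealSubfield L)) L (IsCMField.complexConj L) N H)) νinf a ∘L
          (((cmDatum L N H).rightRegular μ).restrict (finAdelicToAdelic (↥(maximalRealSubfield L)) L (IsCMField.complexConj L) N H)).integratedOperator (((cmDatum L N H).isUnitary_rightRegular μ).restrict _) (((cmDatum L N H).isStronglyContinuous_rightRegular_holds μ).restrict _ (continuous_finAdelicToAdelic (↥(maximalRealSubfield L)) L (IsCMField.complexConj L) N H)) νf b},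
      ∀ x ∈ LinearMap.eqLocus (P : (cmDatum L N H).L2 μ →ₗ[ℂ] (cmDatum L N H).L2 μ) LinearMap.id, P (A' (T b j x)) = T b j (P (A' x)))
    (s : ∀ b, Jb b → Ω b → ℂ) (hs : ∀ b j, MemLp (s b j) ∞ (m b))
    (hU : ∀ b j, ∀ v ∈ LinearMap.eqLocus (P : (cmDatum L N H).L2 μ →ₗ[ℂ] (cmDatum L N H).L2 μ) LinearMap.id, (U b (T b j v)).2 = ((hs b j).toLp (s b j) • (U b v).2 : Lp (E b) 2 (m b)))
    (hline : ∀ b (c : Jb b → ℂ), m b {x | ∀ j, s b j x = c j} = 0)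
    (𝔓 : (cmDatum L N H).ParabolicUnipotentData) :
    ∀ W : ClosedSubrep ((cmDatum L N H).rightRegular μ), W.toContRep.IsTopIrreducible → W ≤ residualSubspace (cmDatum L N H) μ 𝔓 →
      ∀ w ∈ W, ∀ b, (U b (P w)).2 = 0 := by
  intro W hW _ w hw b
  have h := lpModel_blockProj_eq_zero_of_irreducible_subrep_cm ((cmDatum L N H).rightRegular μ) ((cmDatum L N H).isUnitary_rightRegular μ)
    ((cmDatum L N H).isStronglyContinuous_rightRegular_holds μ) νinf νf κ hκ μK χ e hχmul hχone hχinv K' he0 he1 heK hestar P hPdef W hW (T b) (hT𝓐 b) (hTP b) (hTB b)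
    ((LinearMap.snd ℂ (A b) (Lp (E b) 2 (m b))).comp (U b)) (s b) (hs b) (fun j v hv => hU b j v hv) (hline b) hw
  exact h

/-! ## §2 The `hatoms` clause at `(χ, U₀)` -/

/-- **`hatoms` AT `(χ, U₀)` FROM THE LETTERS** — ★ `hatoms_of_noLineMass` (K2E4-p14) fed by §1: with the block-projector fixing letter `hPfix` ((S2c)), the `(χ,U₀)`-part `Eis` with FINITELY
many jointly injective coordinates `U b` (`hEXH`, ★ p860422 + C7) and `hPEis` (`P` maps the irreducible residual `W` into `Eis`), the per-block letters of §1 yield a finite-dimensional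
`A ≤ L²` with `P w ∈ A` for every `w` of every irreducible `W ≤ L²_res` — the `hatoms` binder of ★ `levelFinite_of_atoms` at `(χ, U₀)`. [cite: MoeglinWaldspurger1995, I.2.18, V.3.13] [cite: BorelJacquet1979, §4.6] -/
theorem hatoms_of_letters
    (hχmul : ∀ k l, χ (k * l) = χ k * χ l) (hχone : χ 1 = 1) (hχinv : ∀ k, conj (χ k⁻¹) = χ k)
    (K' : Subgroup (finAdelic (↥(maximalRealSubfield L)) L (IsCMField.complexConj L) N H)) (he0 : ∀ x, x ∉ K' → e x = 0) (he1 : ∫ x, e x ∂νf = 1)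
    (heK : ∀ k ∈ K', ∀ x, e (k * x) = e x) (hestar : ∀ x, mulStar (⇑e) x = e x)
    (P : (cmDatum L N H).L2 μ →L[ℂ] (cmDatum L N H).L2 μ) (hPdef : P = ((((cmDatum L N H).rightRegular μ).restrict ((archToAdelic (↥(maximalRealSubfield L)) L (IsCMField.complexConj L) N H).comp κ)).integratedOperator (((cmDatum L N H).isUnitary_rightRegular μ).restrict _)
          (((cmDatum L N H).isStronglyContinuous_rightRegular_holds μ).restrict _ ((continuous_archToAdelic (↥(maximalRealSubfield L)) L (IsCMField.complexConj L) N H).comp hκ)) μK χ ∘L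
        (((cmDatum L N H).rightRegular μ).restrict (finAdelicToAdelic (↥(maximalRealSubfield L)) L (IsCMField.complexConj L) N H)).integratedOperator (((cmDatum L N H).isUnitary_rightRegular μ).restrict _) (((cmDatum L N H).isStronglyContinuous_rightRegular_holds μ).restrict _ (continuous_finAdelicToAdelic (↥(maximalRealSubfield L)) L (IsCMField.complexConj L) N H)) νf e))
    (U : ∀ b, (cmDatum L N H).L2 μ →ₗ[ℂ] (A b × Lp (E b) 2 (m b)))
    (T : ∀ b, Jb b → (cmDatum L N H).L2 μ →L[ℂ] (cmDatum L N H).L2 μ) (hT𝓐 : ∀ b j, T b j ∈ {A' : (cmDatum L N H).L2 μ →L[ℂ] (cmDatum L N H).L2 μ | ∃ (a : C_c(UnitaryGroup.arch (↥(maximalRealSubfield L)) L (IsCMField.complexConj L) N H, ℂ)) (b : C_c(finAdelic (↥(maximalRealSubfield L)) L (IsCMField.complexConj L) N H, ℂ)),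
      A' = (((cmDatum L N H).rightRegular μ).restrict (archToAdelic (↥(maximalRealSubfield L)) L (IsCMField.complexConj L) N H)).integratedOperator (((cmDatum L N H).isUnitary_rightRegular μ).restrict _) (((cmDatum L N H).isStronglyContinuous_rightRegular_holds μ).restrict _ (continuous_archToAdelic (↥(maximalRealSubfield L)) L (IsCMField.complexConj L) N H)) νinf a ∘L
          (((cmDatum L N H).rightRegular μ).restrict (finAdelicToAdelic (↥(maximalRealSubfield L)) L (IsCMField.complexConj L) N H)).integratedOperator (((cmDatum L N H).isUnitary_rightRegular μ).restrict _) (((cmDatum L N H).isStronglyContinuous_rightRegular_holds μ).restrict _ (continuous_finAdelicToAdelic (↥(maximalRealSubfield L)) L (IsCMField.complexConj L) N H)) νf b})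
    (hTP : ∀ b j, Commute P (T b j))
    (hTB : ∀ b j, ∀ A' ∈ {A' : (cmDatum L N H).L2 μ →L[ℂ] (cmDatum L N H).L2 μ | ∃ (a : C_c(UnitaryGroup.arch (↥(maximalRealSubfield L)) L (IsCMField.complexConj L) N H, ℂ)) (b : C_c(finAdelic (↥(maximalRealSubfield L)) L (IsCMField.complexConj L) N H, ℂ)),
      A' = (((cmDatum L N H).rightRegular μ).restrict (archToAdelic (↥(maximalRealSubfield L)) L (IsCMField.complexConj L) N H)).integratedOperator (((cmDatum L N H).isUnitary_rightRegular μ).restrict _) (((cmDatum L N H).isStronglyContinuous_rightRegular_holds μ).restrict _ (continuous_archToAdelic (↥(maximalRealSubfield L)) L (IsCMField.complexConj L) N H)) νinf a ∘L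
          (((cmDatum L N H).rightRegular μ).restrict (finAdelicToAdelic (↥(maximalRealSubfield L)) L (IsCMField.complexConj L) N H)).integratedOperator (((cmDatum L N H).isUnitary_rightRegular μ).restrict _) (((cmDatum L N H).isStronglyContinuous_rightRegular_holds μ).restrict _ (continuous_finAdelicToAdelic (↥(maximalRealSubfield L)) L (IsCMField.complexConj L) N H)) νf b},
      ∀ x ∈ LinearMap.eqLocus (P : (cmDatum L N H).L2 μ →ₗ[ℂ] (cmDatum L N H).L2 μ) LinearMap.id, P (A' (T b j x)) = T b j (P (A' x)))
    (s : ∀ b, Jb b → Ω b → ℂ) (hs : ∀ b j, MemLp (s b j) ∞ (m b))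
    (hU : ∀ b j, ∀ v ∈ LinearMap.eqLocus (P : (cmDatum L N H).L2 μ →ₗ[ℂ] (cmDatum L N H).L2 μ) LinearMap.id, (U b (T b j v)).2 = ((hs b j).toLp (s b j) • (U b v).2 : Lp (E b) 2 (m b)))
    (hline : ∀ b (c : Jb b → ℂ), m b {x | ∀ j, s b j x = c j} = 0)
    (𝔓 : (cmDatum L N H).ParabolicUnipotentData)
    -- the `(χ, U₀)` data of ★ `hatoms_of_noLineMass`
    {K₀ : Type*} [Group K₀] (ιK : K₀ →* (cmDatum L N H).Adelic) {T₀ : Type*} [Group T₀] (ιa : T₀ →* K₀) {Kf : Type*} [Group Kf] [TopologicalSpace Kf] (ιf : Kf →* K₀)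
    (χ₀ : T₀ →* ℂ) (U₀ : OpenSubgroup Kf)
    (hPfix : ∀ x : (cmDatum L N H).L2 μ, (∀ u ∈ U₀, (cmDatum L N H).rightRegular μ (ιK (ιf u)) x = x) → (∀ t : T₀, (cmDatum L N H).rightRegular μ (ιK (ιa t)) x = χ₀ t • x) → P x = x)
    (Eis : Submodule ℂ ((cmDatum L N H).L2 μ)) (hEXH : ∀ x ∈ Eis, (∀ b, U b x = 0) → x = 0)
    (hPEis : ∀ W : ClosedSubrep ((cmDatum L N H).rightRegular μ), W.toContRep.IsTopIrreducible → W ≤ residualSubspace (cmDatum L N H) μ 𝔓 → ∀ w ∈ W, P w ∈ Eis) :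
    ∃ (P' : (cmDatum L N H).L2 μ →L[ℂ] (cmDatum L N H).L2 μ) (A' : Submodule ℂ ((cmDatum L N H).L2 μ)), FiniteDimensional ℂ A' ∧
      (∀ x : (cmDatum L N H).L2 μ, (∀ u ∈ U₀, (cmDatum L N H).rightRegular μ (ιK (ιf u)) x = x) → (∀ t : T₀, (cmDatum L N H).rightRegular μ (ιK (ιa t)) x = χ₀ t • x) → P' x = x) ∧
      ∀ W : ClosedSubrep ((cmDatum L N H).rightRegular μ), W.toContRep.IsTopIrreducible → W ≤ residualSubspace (cmDatum L N H) μ 𝔓 → ∀ w ∈ W, P' w ∈ A' :=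
  hatoms_of_noLineMass (cmDatum L N H) μ 𝔓 ιK ιa ιf χ₀ U₀ P hPfix Eis U hEXH hPEis
    (hD5_of_letters μ νinf νf κ hκ μK χ e m Jb hχmul hχone hχinv K' he0 he1 heK hestar P hPdef U T hT𝓐 hTP hTB s hs hU hline 𝔓)

/-! ## §3 (ED. 2, dealer (256)) The letter `hPEis` from the residual position of `W` and the `Eis`-membership of `P`-fixed vectors of `(L²_cusp)ᗮ` -/

omit [Finite β] [∀ b, FiniteDimensional ℂ (A b)] [IsFiniteMeasureOnCompacts νinf] [νinf.IsMulLeftInvariant] [νinf.IsInvInvariant] [νinf.IsOpenPosMeasure]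
  [MeasurableSpace (UnitaryGroup.arch (↥(maximalRealSubfield L)) L (IsCMField.complexConj L) N H)] [BorelSpace (UnitaryGroup.arch (↥(maximalRealSubfield L)) L (IsCMField.complexConj L) N H)]
  [νf.IsInvInvariant] [νf.IsOpenPosMeasure] [MeasurableInv K] [μK.IsInvInvariant] [ENNReal.HolderTriple ∞ 2 2] in
/-- **`hPEis` FROM TWO LETTERS**: an irreducible `W ≤ L²_res` lies in `(L²_cusp)ᗮ` (★ `mem_residualPart_iff`), the block projector preserves `(L²_cusp)ᗮ` (★ `cm_blockProjector_hPW` at the closed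
subrepresentation `(L²_cusp)ᗮ`) and is idempotent (★ `cm_blockProjector_hPV` ∘ `apply_eq_of_mem_eqLocus`); so `P w` is a `P`-FIXED vector of `(L²_cusp)ᗮ`, and the C7 letter
`hEisdef : ∀ x ∈ (L²_cusp)ᗮ, P x = x → x ∈ Eis` (K2E1-p10's decomposition: the `(χ,U)`-part of `(L²_cusp)ᗮ` lies in the closure of the family blocks) puts it in `Eis`.
[cite: MoeglinWaldspurger1995, I.2.18, II.2.4] -/
theorem hPEis_of_letters
    (hχmul : ∀ k l, χ (k * l) = χ k * χ l) (hχone : χ 1 = 1)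
    (K' : Subgroup (finAdelic (↥(maximalRealSubfield L)) L (IsCMField.complexConj L) N H)) (he0 : ∀ x, x ∉ K' → e x = 0) (he1 : ∫ x, e x ∂νf = 1) (heK : ∀ k ∈ K', ∀ x, e (k * x) = e x)
    (P : (cmDatum L N H).L2 μ →L[ℂ] (cmDatum L N H).L2 μ) (hPdef : P = ((((cmDatum L N H).rightRegular μ).restrict ((archToAdelic (↥(maximalRealSubfield L)) L (IsCMField.complexConj L) N H).comp κ)).integratedOperator (((cmDatum L N H).isUnitary_rightRegular μ).restrict _)
          (((cmDatum L N H).isStronglyContinuous_rightRegular_holds μ).restrict _ ((continuous_archToAdelic (↥(maximalRealSubfield L)) L (IsCMField.complexConj L) N H).comp hκ)) μK χ ∘L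
        (((cmDatum L N H).rightRegular μ).restrict (finAdelicToAdelic (↥(maximalRealSubfield L)) L (IsCMField.complexConj L) N H)).integratedOperator (((cmDatum L N H).isUnitary_rightRegular μ).restrict _) (((cmDatum L N H).isStronglyContinuous_rightRegular_holds μ).restrict _ (continuous_finAdelicToAdelic (↥(maximalRealSubfield L)) L (IsCMField.complexConj L) N H)) νf e))
    (𝔓 : (cmDatum L N H).ParabolicUnipotentData) (Eis : Submodule ℂ ((cmDatum L N H).L2 μ))
    (hEisdef : ∀ x : (cmDatum L N H).L2 μ, x ∈ ((cmDatum L N H).cuspidalSubspace μ 𝔓).orthogonal ((cmDatum L N H).isUnitary_rightRegular μ) → P x = x → x ∈ Eis) :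
    ∀ W : ClosedSubrep ((cmDatum L N H).rightRegular μ), W.toContRep.IsTopIrreducible → W ≤ residualSubspace (cmDatum L N H) μ 𝔓 → ∀ w ∈ W, P w ∈ Eis := by
  intro W _ hWres w hw
  -- `w ∈ (L²_cusp)ᗮ`
  have hwo : w ∈ ((cmDatum L N H).cuspidalSubspace μ 𝔓).orthogonal ((cmDatum L N H).isUnitary_rightRegular μ) := by
    have h := (mem_residualPart_iff ((cmDatum L N H).isUnitary_rightRegular μ) _ _).1 (hWres hw)
    exact (ClosedSubrep.mem_orthogonal_iff _ _ w).2 h.2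
  refine hEisdef (P w) ?_ ?_
  · subst hPdef
    exact cm_blockProjector_hPW ((cmDatum L N H).rightRegular μ) ((cmDatum L N H).isUnitary_rightRegular μ) ((cmDatum L N H).isStronglyContinuous_rightRegular_holds μ)
      νf κ hκ μK χ e _ w hwo
  · have hPV : P (P w) = P w := by
      subst hPdef
      exact apply_eq_of_mem_eqLocus _ _ (cm_blockProjector_hPV ((cmDatum L N H).rightRegular μ) ((cmDatum L N H).isUnitary_rightRegular μ)
        ((cmDatum L N H).isStronglyContinuous_rightRegular_holds μ) νf κ hκ μK χ e hχmul hχone K' he0 he1 heK w)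
    exact hPV

/-! ## §4 (ED. 3, dealer (259)∕K2E1-p10 13:46:47Z bytes) The C7 letter `hEisdef` at the TRIVIAL `K_∞`-type: `P`-fixed vectors of `(L²_cusp)ᗮ` are `K′`-invariant -/

omit [Finite β] [∀ b, FiniteDimensional ℂ (A b)] [IsFiniteMeasureOnCompacts νinf] [νinf.IsMulLeftInvariant] [νinf.IsInvInvariant] [νinf.IsOpenPosMeasure]
  [MeasurableSpace (UnitaryGroup.arch (↥(maximalRealSubfield L)) L (IsCMField.complexConj L) N H)] [BorelSpace (UnitaryGroup.arch (↥(maximalRealSubfield L)) L (IsCMField.complexConj L) N H)]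
  [νf.IsInvInvariant] [νf.IsOpenPosMeasure] [MeasurableInv K] [μK.IsInvInvariant] [ENNReal.HolderTriple ∞ 2 2] [IsProbabilityMeasure μK] in
/-- **`hEisdef` DISCHARGED AT τ = 1** (K2E1-p10's `Eis := (L²_cusp)ᗮ ⊓ (R|_{K′})-invariants` with `K′ ≤ closure (ι_∞ κ(K) ∪ ι_f(K′_f))`, `χ ≡ 1`): a vector `x ∈ (L²_cusp)ᗮ` with `P x = x`,
`P = P_1 ∘L R_f(e_{K′_f})`, is fixed by every `ι_∞(κ k)` (★ `apply_comp_integratedOperator_eq_self_of_forall_mul_eq` for the `K`-average `P_1`, `μ_K` left-invariant) and by every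
`ι_f(k_f)`, `k_f ∈ K′_f` (the same ★ lemma for the left-`K′_f`-invariant `e`, after ★ `restrict_comp_integratedOperator_comm` moves `R(ι_f k_f)` past `P_1`), hence by the closure they
generate. [cite: DeitmarEchterhoff2014, Lemma 1.6.3] [cite: BorelJacquet1979, §4.1] -/
theorem hEisdef_of_trivial_kType [MeasurableMul (finAdelic (↥(maximalRealSubfield L)) L (IsCMField.complexConj L) N H)]
    (hχ1 : ∀ k, χ k = 1)
    (K' : Subgroup (finAdelic (↥(maximalRealSubfield L)) L (IsCMField.complexConj L) N H)) (heK : ∀ k ∈ K', ∀ x, e (k * x) = e x)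
    (P : (cmDatum L N H).L2 μ →L[ℂ] (cmDatum L N H).L2 μ) (hPdef : P = ((((cmDatum L N H).rightRegular μ).restrict ((archToAdelic (↥(maximalRealSubfield L)) L (IsCMField.complexConj L) N H).comp κ)).integratedOperator (((cmDatum L N H).isUnitary_rightRegular μ).restrict _)
          (((cmDatum L N H).isStronglyContinuous_rightRegular_holds μ).restrict _ ((continuous_archToAdelic (↥(maximalRealSubfield L)) L (IsCMField.complexConj L) N H).comp hκ)) μK χ ∘L
        (((cmDatum L N H).rightRegular μ).restrict (finAdelicToAdelic (↥(maximalRealSubfield L)) L (IsCMField.complexConj L) N H)).integratedOperator (((cmDatum L N H).isUnitary_rightRegular μ).restrict _) (((cmDatum L N H).isStronglyContinuous_rightRegular_holds μ).restrict _ (continuous_finAdelicToAdelic (↥(maximalRealSubfield L)) L (IsCMField.complexConj L) N H)) νf e))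
    (𝔓 : (cmDatum L N H).ParabolicUnipotentData) (Kad : Subgroup (cmDatum L N H).Adelic)
    (hKad : Kad ≤ Subgroup.closure (Set.range (fun k : K => (archToAdelic (↥(maximalRealSubfield L)) L (IsCMField.complexConj L) N H) (κ k)) ∪ (finAdelicToAdelic (↥(maximalRealSubfield L)) L (IsCMField.complexConj L) N H) '' (K' : Set (finAdelic (↥(maximalRealSubfield L)) L (IsCMField.complexConj L) N H)))) :
    ∀ x : (cmDatum L N H).L2 μ, x ∈ ((cmDatum L N H).cuspidalSubspace μ 𝔓).orthogonal ((cmDatum L N H).isUnitary_rightRegular μ) → P x = x →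
      x ∈ ((cmDatum L N H).cuspidalSubspace μ 𝔓).toSubmoduleᗮ ⊓ (((cmDatum L N H).rightRegular μ).restrict Kad.subtype).invariants := by
  intro x hxo hPx
  refine Submodule.mem_inf.2 ⟨hxo, ?_⟩
  rw [ContRepresentation.mem_invariants]
  have hcomm : ∀ (k : K) (y : finAdelic (↥(maximalRealSubfield L)) L (IsCMField.complexConj L) N H), ((archToAdelic (↥(maximalRealSubfield L)) L (IsCMField.complexConj L) N H).comp κ) k * (finAdelicToAdelic (↥(maximalRealSubfield L)) L (IsCMField.complexConj L) N H) y = (finAdelicToAdelic (↥(maximalRealSubfield L)) L (IsCMField.complexConj L) N H) y * ((archToAdelic (↥(maximalRealSubfield L)) L (IsCMField.complexConj L) N H).comp κ) k :=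
    fun k y => K2E1PureTensorHeckeAlgebraU.cm_hcomm (κ k) y
  -- the archimedean generators fix `P v`
  have harch : ∀ (k : K) (v : (cmDatum L N H).L2 μ), ((cmDatum L N H).rightRegular μ) ((archToAdelic (↥(maximalRealSubfield L)) L (IsCMField.complexConj L) N H) (κ k)) (P v) = P v := fun k v => by
    subst hPdef
    have h := congrArg (fun T : (cmDatum L N H).L2 μ →L[ℂ] (cmDatum L N H).L2 μ => T ((((cmDatum L N H).rightRegular μ).restrict (finAdelicToAdelic (↥(maximalRealSubfield L)) L (IsCMField.complexConj L) N H)).integratedOperator (((cmDatum L N H).isUnitary_rightRegular μ).restrict _) (((cmDatum L N H).isStronglyContinuous_rightRegular_holds μ).restrict _ (continuous_finAdelicToAdelic (↥(maximalRealSubfield L)) L (IsCMField.complexConj L) N H)) νf e v))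
      (ContRepresentation.apply_comp_integratedOperator_eq_self_of_forall_mul_eq (((cmDatum L N H).isUnitary_rightRegular μ).restrict ((archToAdelic (↥(maximalRealSubfield L)) L (IsCMField.complexConj L) N H).comp κ))
        (((cmDatum L N H).isStronglyContinuous_rightRegular_holds μ).restrict _ ((continuous_archToAdelic (↥(maximalRealSubfield L)) L (IsCMField.complexConj L) N H).comp hκ)) μK ⊤ χ (fun k _ y => by rw [hχ1, hχ1]) (Subgroup.mem_top k))
    exact h
  -- the finite-level generators fix `P v`
  have hfin : ∀ kf ∈ K', ∀ v : (cmDatum L N H).L2 μ, ((cmDatum L N H).rightRegular μ) ((finAdelicToAdelic (↥(maximalRealSubfield L)) L (IsCMField.complexConj L) N H) kf) (P v) = P v := fun kf hkf v => by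
    subst hPdef
    have h1 := congrArg (fun T : (cmDatum L N H).L2 μ →L[ℂ] (cmDatum L N H).L2 μ => T ((((cmDatum L N H).rightRegular μ).restrict (finAdelicToAdelic (↥(maximalRealSubfield L)) L (IsCMField.complexConj L) N H)).integratedOperator (((cmDatum L N H).isUnitary_rightRegular μ).restrict _) (((cmDatum L N H).isStronglyContinuous_rightRegular_holds μ).restrict _ (continuous_finAdelicToAdelic (↥(maximalRealSubfield L)) L (IsCMField.complexConj L) N H)) νf e v))
      (K2E1PureTensorHeckeAlgebraU.restrict_comp_integratedOperator_comm ((cmDatum L N H).rightRegular μ) ((cmDatum L N H).isUnitary_rightRegular μ) ((cmDatum L N H).isStronglyContinuous_rightRegular_holds μ) ((archToAdelic (↥(maximalRealSubfield L)) L (IsCMField.complexConj L) N H).comp κ) ((continuous_archToAdelic (↥(maximalRealSubfield L)) L (IsCMField.complexConj L) N H).comp hκ) (finAdelicToAdelic (↥(maximalRealSubfield L)) L (IsCMField.complexConj L) N H) μK hcomm kf χ)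
    have h2 := congrArg (fun T : (cmDatum L N H).L2 μ →L[ℂ] (cmDatum L N H).L2 μ => T v)
      (ContRepresentation.apply_comp_integratedOperator_eq_self_of_forall_mul_eq (((cmDatum L N H).isUnitary_rightRegular μ).restrict (finAdelicToAdelic (↥(maximalRealSubfield L)) L (IsCMField.complexConj L) N H))
        (((cmDatum L N H).isStronglyContinuous_rightRegular_holds μ).restrict _ (continuous_finAdelicToAdelic (↥(maximalRealSubfield L)) L (IsCMField.complexConj L) N H)) νf K' e heK hkf)
    have h2' : ((cmDatum L N H).rightRegular μ) ((finAdelicToAdelic (↥(maximalRealSubfield L)) L (IsCMField.complexConj L) N H) kf) ((((cmDatum L N H).rightRegular μ).restrict (finAdelicToAdelic (↥(maximalRealSubfield L)) L (IsCMField.complexConj L) N H)).integratedOperator (((cmDatum L N H).isUnitary_rightRegular μ).restrict _) (((cmDatum L N H).isStronglyContinuous_rightRegular_holds μ).restrict _ (continuous_finAdelicToAdelic (↥(maximalRealSubfield L)) L (IsCMField.complexConj L) N H)) νf e v) = (((cmDatum L N H).rightRegular μ).restrict (finAdelicToAdelic (↥(maximalRealSubfield L)) L (IsCMField.complexConj L)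 N H)).integratedOperator (((cmDatum L N H).isUnitary_rightRegular μ).restrict _) (((cmDatum L N H).isStronglyContinuous_rightRegular_holds μ).restrict _ (continuous_finAdelicToAdelic (↥(maximalRealSubfield L)) L (IsCMField.complexConj L) N H)) νf e v := h2
    have h1' : ((cmDatum L N H).rightRegular μ) ((finAdelicToAdelic (↥(maximalRealSubfield L)) L (IsCMField.complexConj L) N H) kf) ((((cmDatum L N H).rightRegular μ).restrict ((archToAdelic (↥(maximalRealSubfield L)) L (IsCMField.complexConj L) N H).comp κ)).integratedOperator (((cmDatum L N H).isUnitary_rightRegular μ).restrict _)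
          (((cmDatum L N H).isStronglyContinuous_rightRegular_holds μ).restrict _ ((continuous_archToAdelic (↥(maximalRealSubfield L)) L (IsCMField.complexConj L) N H).comp hκ)) μK χ ((((cmDatum L N H).rightRegular μ).restrict (finAdelicToAdelic (↥(maximalRealSubfield L)) L (IsCMField.complexConj L) N H)).integratedOperator (((cmDatum L N H).isUnitary_rightRegular μ).restrict _) (((cmDatum L N H).isStronglyContinuous_rightRegular_holds μ).restrict _ (continuous_finAdelicToAdelic (↥(maximalRealSubfield L)) L (IsCMField.complexConj L) N H)) νf e v)) =
        (((cmDatum L N H).rightRegular μ).restrict ((archToAdelic (↥(maximalRealSubfield L)) L (IsCMField.complexConj L) N H).comp κ)).integratedOperator (((cmDatum L N H).isUnitary_rightRegular μ).restrict _)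
          (((cmDatum L N H).isStronglyContinuous_rightRegular_holds μ).restrict _ ((continuous_archToAdelic (↥(maximalRealSubfield L)) L (IsCMField.complexConj L) N H).comp hκ)) μK χ (((cmDatum L N H).rightRegular μ) ((finAdelicToAdelic (↥(maximalRealSubfield L)) L (IsCMField.complexConj L) N H) kf) ((((cmDatum L N H).rightRegular μ).restrict (finAdelicToAdelic (↥(maximalRealSubfield L)) L (IsCMField.complexConj L) N H)).integratedOperator (((cmDatum L N H).isUnitary_rightRegular μ).restrict _) (((cmDatum L N H).isStronglyContinuous_rightRegular_holds μ).restrict _ (continuous_finAdelicToAdelic (↥(maximalRealSubfield L)) L (IsCMField.complexConj L) N H)) νf e v)) := h1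
    change ((cmDatum L N H).rightRegular μ) ((finAdelicToAdelic (↥(maximalRealSubfield L)) L (IsCMField.complexConj L) N H) kf) ((((cmDatum L N H).rightRegular μ).restrict ((archToAdelic (↥(maximalRealSubfield L)) L (IsCMField.complexConj L) N H).comp κ)).integratedOperator (((cmDatum L N H).isUnitary_rightRegular μ).restrict _)
          (((cmDatum L N H).isStronglyContinuous_rightRegular_holds μ).restrict _ ((continuous_archToAdelic (↥(maximalRealSubfield L)) L (IsCMField.complexConj L) N H).comp hκ)) μK χ ((((cmDatum L N H).rightRegular μ).restrict (finAdelicToAdelic (↥(maximalRealSubfield L)) L (IsCMField.complexConj L) N H)).integratedOperator (((cmDatum L N H).isUnitary_rightRegular μ).restrict _) (((cmDatum L N H).isStronglyContinuous_rightRegular_holds μ).restrict _ (continuous_finAdelicToAdelic (↥(maximalRealSubfield L)) L (IsCMField.complexConj L) N H)) νf e v)) = (((cmDatum L N H).rightRegular μ).restrict ((archToAdelic (↥(maximalRealSubfield L)) L (IsCMField.complexConj L) N H).comp κ)).integratedOperator (((cmDatum L N H).isUnitary_rightRegular μ).restrict _)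
          (((cmDatum L N H).isStronglyContinuous_rightRegular_holds μ).restrict _ ((continuous_archToAdelic (↥(maximalRealSubfield L)) L (IsCMField.complexConj L) N H).comp hκ)) μK χ ((((cmDatum L N H).rightRegular μ).restrict (finAdelicToAdelic (↥(maximalRealSubfield L)) L (IsCMField.complexConj L) N H)).integratedOperator (((cmDatum L N H).isUnitary_rightRegular μ).restrict _) (((cmDatum L N H).isStronglyContinuous_rightRegular_holds μ).restrict _ (continuous_finAdelicToAdelic (↥(maximalRealSubfield L)) L (IsCMField.complexConj L) N H)) νf e v)
    rw [h1', h2']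
  -- the stabiliser of `x` contains the closure of the generators
  have hgen : ∀ g ∈ Set.range (fun k : K => (archToAdelic (↥(maximalRealSubfield L)) L (IsCMField.complexConj L) N H) (κ k)) ∪ (finAdelicToAdelic (↥(maximalRealSubfield L)) L (IsCMField.complexConj L) N H) '' (K' : Set (finAdelic (↥(maximalRealSubfield L)) L (IsCMField.complexConj L) N H)), ((cmDatum L N H).rightRegular μ) g x = x := by
    rintro g (⟨k, rfl⟩ | ⟨kf, hkf, rfl⟩)
    · have h := harch k x
      rwa [hPx] at h
    · have h := hfin kf hkf x
      rwa [hPx] at h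
  have hcl : ∀ g ∈ Subgroup.closure (Set.range (fun k : K => (archToAdelic (↥(maximalRealSubfield L)) L (IsCMField.complexConj L) N H) (κ k)) ∪ (finAdelicToAdelic (↥(maximalRealSubfield L)) L (IsCMField.complexConj L) N H) '' (K' : Set (finAdelic (↥(maximalRealSubfield L)) L (IsCMField.complexConj L) N H))), ((cmDatum L N H).rightRegular μ) g x = x := by
    intro g hg
    refine Subgroup.closure_induction (p := fun g _ => ((cmDatum L N H).rightRegular μ) g x = x) (fun g hg' => hgen g hg') ?_ ?_ ?_ hg
    · rw [map_one]; rfl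
    · intro a b _ _ ha hb
      rw [map_mul]
      change ((cmDatum L N H).rightRegular μ) a (((cmDatum L N H).rightRegular μ) b x) = x
      rw [hb, ha]
    · intro a _ ha
      have h := congrArg (((cmDatum L N H).rightRegular μ) a⁻¹) ha
      change (((cmDatum L N H).rightRegular μ) a⁻¹ * ((cmDatum L N H).rightRegular μ) a) x = ((cmDatum L N H).rightRegular μ) a⁻¹ x at h
      rw [← map_mul, inv_mul_cancel, map_one] at h
      exact h.symm
  intro k
  exact hcl _ (hKad k.2)

end Summit.HodgeConjecture.HodgeConjecture.Cruxes.H413.K2E1ResidualPartInAtomsCMTwo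

end
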